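import Literature.Geometry.Kaehler.FibrePrimitiveProductSmooth
import HarnessLib

/-!
# The reduced fibre primitive: removing the explicit factor `t`

Continuation of `FibrePrimitiveProduct.lean` / `FibrePrimitiveProductSmooth.lean`.  The fibre
homotopy operator carries an explicit factor `t`: `K ω (u, t) = t • K̃ ω (u, t)` with the
**reduced operator** `K̃ ω (u, t) = ∫₀¹ H_σ^* (ι_{(0,1)} ω (u, σ t)) dσ`.  In the Moser argument near
a fold (Cannas da Silva–Guillemin–Woodward 2000, proof of Thm. 1) the Moser vector
`-Pf(ω_s)⁻¹ · adj(ω_s) μ` with `μ = K(ω₀ - Ω) = t μ̃` and `Pf(ω_s) = t π_s` is smooth across the fold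
because `μ̃ = K̃(ω₀ - Ω)` is (`MoserVectorFour.alt_two_moserVector_cancel`).  This file proves that:

* flat: `fibreReducedIntegrand`, `fibreReducedOperator`, `linHomOperator_eq_smul_fibreReducedOperator`
  (`K = t • K̃`), `contDiff_fibreReducedOperator`, `contDiffOn_fibreReducedOperator` (localised to
  fibre-star-shaped open sets by cut-offs);
* manifold: `fibrePrimitiveReduced η` on `N × ℝ`, `fibrePrimitive_eq_smul_fibrePrimitiveReduced`,
  the chart identity `inChart_fibrePrimitiveReduced`, and **`smoothAt_fibrePrimitiveReduced`**: for
  `η` smooth on `N × J` (`J` open, star-shaped at `0`) the reduced fibre primitive is smooth there.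

## References

* D. McDuff, D. Salamon, *Introduction to Symplectic Topology*, 3rd ed. (2017), §3.2.
  [McDuffSalamon2017]
* A. Cannas da Silva, V. Guillemin, C. Woodward, *On the unfolding of folded symplectic
  structures*, Math. Res. Lett. 7 (2000), proof of Thm. 1. [CannasGuilleminWoodward2000]
-/

noncomputable section

open scoped Topology ContDiff Manifold
open Set Filter MeasureTheory intervalIntegral ContinuousAlternatingMap
open Literature.Topology.FourManifolds

namespace Literature.Geometry.Kaehler

/-! ## The reduced fibre operator: the explicit factor `t` removed -/

section ReducedFlat

variable {E' : Type*} [NormedAddCommGroup E'] [NormedSpace ℝ E'] {F : Type*} [NormedAddCommGroup F]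
  [NormedSpace ℝ F] {k : ℕ}

/-- The integrand of the reduced fibre operator on `E' × ℝ`:
`(σ, (u, t)) ↦ H_σ^* (ι_{(0,1)} ω (u, σ t))`. [folklore] -/
def fibreReducedIntegrand (β : E' × ℝ → (E' × ℝ) [⋀^Fin (k + 1)]→L[ℝ] F) (p : ℝ × (E' × ℝ)) :
    (E' × ℝ) [⋀^Fin k]→L[ℝ] F :=
  ((β (p.2.1, p.1 * p.2.2)).curryLeft (((0 : E'), (1 : ℝ)) : E' × ℝ)).compContinuousLinearMap
    (linHom ((ContinuousLinearMap.inr ℝ E' ℝ).comp (ContinuousLinearMap.snd ℝ E' ℝ)) p.1)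

/-- **The reduced fibre operator** `K̃ ω (u, t) = ∫₀¹ H_σ^* (ι_{(0,1)} ω (u, σ t)) dσ`, so that the
fibre homotopy operator is `K ω (u, t) = t • K̃ ω (u, t)` (`linHomOperator_eq_smul_fibreReducedOperator`).
[cite: McDuffSalamon2017, Lemma 3.2.1] -/
def fibreReducedOperator (β : E' × ℝ → (E' × ℝ) [⋀^Fin (k + 1)]→L[ℝ] F) (x : E' × ℝ) :
    (E' × ℝ) [⋀^Fin k]→L[ℝ] F :=
  ∫ σ in (0 : ℝ)..1, fibreReducedIntegrand β (σ, x)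

/-- `K ω (u, t) = t • K̃ ω (u, t)`. [folklore] -/
theorem linHomOperator_eq_smul_fibreReducedOperator (β : E' × ℝ → (E' × ℝ) [⋀^Fin (k + 1)]→L[ℝ] F)
    (x : E' × ℝ) :
    linHomOperator ((ContinuousLinearMap.inr ℝ E' ℝ).comp (ContinuousLinearMap.snd ℝ E' ℝ)) β x =
      x.2 • fibreReducedOperator β x :=
  linHomOperator_inr_comp_snd β x

/-- `K̃ ω x` depends only on `ω` along the segment `{(u, σ t)}`. [folklore] -/
theorem fibreReducedOperator_congr {β β' : E' × ℝ → (E' × ℝ) [⋀^Fin (k + 1)]→L[ℝ] F} {x : E' × ℝ}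
    (h : ∀ σ ∈ Icc (0 : ℝ) 1, β (x.1, σ * x.2) = β' (x.1, σ * x.2)) :
    fibreReducedOperator β x = fibreReducedOperator β' x := by
  refine intervalIntegral.integral_congr fun σ hσ ↦ ?_
  rw [uIcc_of_le zero_le_one] at hσ
  simp only [fibreReducedIntegrand, h σ hσ]

/-- The reduced integrand is jointly `C^∞` for `C^∞` forms. [folklore] -/
theorem contDiff_fibreReducedIntegrand {β : E' × ℝ → (E' × ℝ) [⋀^Fin (k + 1)]→L[ℝ] F}
    (hβ : ContDiff ℝ ∞ β) : ContDiff ℝ ∞ (fibreReducedIntegrand β) := by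
  have hpt : ContDiff ℝ ∞ (fun p : ℝ × (E' × ℝ) ↦ ((p.2.1, p.1 * p.2.2) : E' × ℝ)) :=
    (contDiff_fst.comp contDiff_snd).prodMk (contDiff_fst.mul (contDiff_snd.comp contDiff_snd))
  have hJ : ContDiff ℝ ∞ (fun p : ℝ × (E' × ℝ) ↦
      (β (p.2.1, p.1 * p.2.2)).curryLeft (((0 : E'), (1 : ℝ)) : E' × ℝ)) :=
    (isBoundedBilinearMap_curryLeft (E := E' × ℝ) (F := F) (k := k)).contDiff.comp
      ((hβ.comp hpt).prodMk contDiff_const)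
  have hL : ContDiff ℝ ∞ (fun p : ℝ × (E' × ℝ) ↦
      linHom ((ContinuousLinearMap.inr ℝ E' ℝ).comp (ContinuousLinearMap.snd ℝ E' ℝ)) p.1) :=
    (contDiff_linHom _).comp contDiff_fst
  rw [contDiff_iff_contDiffAt]
  intro p
  exact
    Literature.NumberTheory.Transcendental.ContDiffAt.continuousAlternatingMapCompContinuousLinearMap
      hJ.contDiffAt hL.contDiffAt

variable [FiniteDimensional ℝ E']

/-- **`K̃` preserves smoothness** (globally smooth forms). [folklore] -/
theorem contDiff_fibreReducedOperator {β : E' × ℝ → (E' × ℝ) [⋀^Fin (k + 1)]→L[ℝ] F}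
    (hβ : ContDiff ℝ ∞ β) : ContDiff ℝ ∞ (fibreReducedOperator β) :=
  Literature.Analysis.FunctionSpaces.contDiff_parametric_intervalIntegral
    (contDiff_fibreReducedIntegrand hβ) 0 1

/-- **`K̃` preserves smoothness on fibre-star-shaped open sets** (localisation by cut-offs, as
for `linHomOperator`). [folklore] -/
theorem contDiffOn_fibreReducedOperator {U : Set (E' × ℝ)} (hU : IsOpen U)
    (hst : ∀ p ∈ U, ∀ σ ∈ Icc (0 : ℝ) 1,
      linHom ((ContinuousLinearMap.inr ℝ E' ℝ).comp (ContinuousLinearMap.snd ℝ E' ℝ)) σ p ∈ U)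
    {β : E' × ℝ → (E' × ℝ) [⋀^Fin (k + 1)]→L[ℝ] F} (hβ : ContDiffOn ℝ ∞ β U) :
    ContDiffOn ℝ ∞ (fibreReducedOperator β) U := by
  intro p hp
  -- cut-off equal to `1` near the segment of `p`
  set Qv := (ContinuousLinearMap.inr ℝ E' ℝ).comp (ContinuousLinearMap.snd ℝ E' ℝ) with hQv
  have hS : (fun σ : ℝ ↦ linHom Qv σ p) '' Icc (0 : ℝ) 1 ⊆ U := by
    rintro _ ⟨σ, hσ, rfl⟩
    exact hst p hp σ hσ
  obtain ⟨ψ, hψ, h1, h0⟩ :=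
    exists_contDiff_one_nhdsSet_of_isCompact (isCompact_linHom_segment Qv p) hU hS
  obtain ⟨Nb, hNb, hSN, hNs⟩ := mem_nhdsSet_iff_exists.1 h1
  have hN1 : ∀ y ∈ Nb, ψ y = 1 := fun y hy ↦ hNs hy
  have hβ' : ContDiff ℝ ∞ fun y ↦ ψ y • β y := contDiff_smul_of_eventuallyEq_zero hU hψ h0 hβ
  have hK : ∀ᶠ q in 𝓝 p, fibreReducedOperator (fun y ↦ ψ y • β y) q = fibreReducedOperator β q := by
    filter_upwards [eventually_linHom_mem Qv hNb hSN] with q hq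
    refine fibreReducedOperator_congr fun σ hσ ↦ ?_
    have hq' := hq σ hσ
    rw [hQv, linHom_inr_comp_snd_apply] at hq'
    rw [hN1 _ hq', one_smul]
  exact ((contDiff_fibreReducedOperator hβ').contDiffAt.congr_of_eventuallyEq
    (hK.mono fun q hq ↦ hq.symm)).contDiffWithinAt

end ReducedFlat

/-! ## The reduced fibre primitive on `N × ℝ` -/

section ReducedManifold

variable {m : ℕ} {F : Type*} [NormedAddCommGroup F] [NormedSpace ℝ F] {k : ℕ}
variable {N : Type*} [TopologicalSpace N] [ChartedSpace (EuclideanSpace ℝ (Fin m)) N]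

/-- **The reduced fibre primitive** of a `(k+1)`-form on `N × ℝ`:
`(n, t) ↦ ∫₀¹ H_σ^* (ι_{(0,1)} η (n, σ t)) dσ`, so that `fibrePrimitive η = t • fibrePrimitiveReduced η`.
[cite: McDuffSalamon2017, Lemma 3.2.1] -/
def fibrePrimitiveReduced (η : MForm ((𝓡 m).prod 𝓘(ℝ, ℝ)) (N × ℝ) F (k + 1)) :
    MForm ((𝓡 m).prod 𝓘(ℝ, ℝ)) (N × ℝ) F k := fun x ↦
  fibreReducedOperator
    (fun p : EuclideanSpace ℝ (Fin m) × ℝ ↦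
      (η (x.1, p.2) : (EuclideanSpace ℝ (Fin m) × ℝ) [⋀^Fin (k + 1)]→L[ℝ] F))
    (((0 : EuclideanSpace ℝ (Fin m)), x.2) : EuclideanSpace ℝ (Fin m) × ℝ)

/-- The reduced fibre primitive as an explicit integral. [folklore] -/
theorem fibrePrimitiveReduced_apply (η : MForm ((𝓡 m).prod 𝓘(ℝ, ℝ)) (N × ℝ) F (k + 1))
    (x : N × ℝ) :
    fibrePrimitiveReduced η x = ∫ σ in (0 : ℝ)..1,
      (((η (x.1, σ * x.2) : (EuclideanSpace ℝ (Fin m) × ℝ) [⋀^Fin (k + 1)]→L[ℝ] F)).curryLeft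
        (((0 : EuclideanSpace ℝ (Fin m)), (1 : ℝ)) : EuclideanSpace ℝ (Fin m) × ℝ)).compContinuousLinearMap
        (linHom (vertQ m) σ) := rfl

/-- **`fibrePrimitive η = t • fibrePrimitiveReduced η`.** [cite: McDuffSalamon2017, Lemma 3.2.1] -/
theorem fibrePrimitive_eq_smul_fibrePrimitiveReduced
    (η : MForm ((𝓡 m).prod 𝓘(ℝ, ℝ)) (N × ℝ) F (k + 1)) (x : N × ℝ) :
    fibrePrimitive η x = x.2 • fibrePrimitiveReduced η x :=
  fibrePrimitive_eq_smul η x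

/-- Algebra of the reduced integrands: conjugation by `τ × id` passes through `ι_{(0,1)}` and
`H_σ^*`. [folklore] -/
theorem curryLeft_one_compContinuousLinearMap_prodMap
    (A : (EuclideanSpace ℝ (Fin m) × ℝ) [⋀^Fin (k + 1)]→L[ℝ] F)
    (τ : EuclideanSpace ℝ (Fin m) →L[ℝ] EuclideanSpace ℝ (Fin m)) (σ : ℝ) :
    ((A.compContinuousLinearMap (τ.prodMap (ContinuousLinearMap.id ℝ ℝ))).curryLeft
        (((0 : EuclideanSpace ℝ (Fin m)), (1 : ℝ)) : EuclideanSpace ℝ (Fin m) × ℝ)).compContinuousLinearMap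
        (linHom (vertQ m) σ) =
      (((A.curryLeft (((0 : EuclideanSpace ℝ (Fin m)), (1 : ℝ)) : EuclideanSpace ℝ (Fin m) × ℝ))
        |>.compContinuousLinearMap (linHom (vertQ m) σ)).compContinuousLinearMap
          (τ.prodMap (ContinuousLinearMap.id ℝ ℝ))) :=
  curryLeft_compContinuousLinearMap_prodMap A τ σ 1

variable [IsManifold (𝓡 m) ∞ N]

/-- **In a product chart the reduced fibre primitive is the flat reduced operator of the
representative.** [folklore] -/
theorem inChart_fibrePrimitiveReduced (η : MForm ((𝓡 m).prod 𝓘(ℝ, ℝ)) (N × ℝ) F (k + 1))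
    {x₀ : N × ℝ} {y : EuclideanSpace ℝ (Fin m) × ℝ}
    (hy : y ∈ (extChartAt ((𝓡 m).prod 𝓘(ℝ, ℝ)) x₀).target) :
    (fibrePrimitiveReduced η).inChart x₀ y = fibreReducedOperator (η.inChart x₀) y := by
  have hy1 : y.1 ∈ (extChartAt (𝓡 m) x₀.1).target := mem_extChartAt_prod_real_target.1 hy
  set n : N := (extChartAt (𝓡 m) x₀.1).symm y.1 with hn
  have hns : n ∈ (extChartAt (𝓡 m) x₀.1).source := (extChartAt (𝓡 m) x₀.1).map_target hy1
  obtain ⟨e, he⟩ := exists_equiv_eq_tangentCoordChange hns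
  have hT : ∀ s : ℝ, tangentCoordChange ((𝓡 m).prod 𝓘(ℝ, ℝ)) x₀ ((n, s) : N × ℝ) (n, s) =
      (e : EuclideanSpace ℝ (Fin m) →L[ℝ] EuclideanSpace ℝ (Fin m)).prodMap
        (ContinuousLinearMap.id ℝ ℝ) := fun s ↦ by
    rw [tangentCoordChange_prod_real (mem_extChartAt_prod_real_source.2 hns), he]
  have hsymm : ∀ s : ℝ, (extChartAt ((𝓡 m).prod 𝓘(ℝ, ℝ)) x₀).symm (y.1, s) = (n, s) := fun s ↦ by
    rw [extChartAt_prod_real_symm_eq]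
  have hmem : ∀ s : ℝ, ((y.1, s) : EuclideanSpace ℝ (Fin m) × ℝ) ∈
      (extChartAt ((𝓡 m).prod 𝓘(ℝ, ℝ)) x₀).target := fun s ↦
    mem_extChartAt_prod_real_target.2 hy1
  have hy' : y = (y.1, y.2) := rfl
  rw [MForm.inChart_eq_of_mem_target _ hy]
  conv_lhs => rw [hy', hsymm y.2, hT y.2]
  rw [fibrePrimitiveReduced_apply]
  have hswap := intervalIntegral_compContinuousLinearMap_prodMap (k := k) (F := F) e
    (fun σ : ℝ ↦ (((η (n, σ * y.2) :
      (EuclideanSpace ℝ (Fin m) × ℝ) [⋀^Fin (k + 1)]→L[ℝ] F)).curryLeft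
        (((0 : EuclideanSpace ℝ (Fin m)), (1 : ℝ)) : EuclideanSpace ℝ (Fin m) × ℝ)).compContinuousLinearMap
        (linHom (vertQ m) σ))
  refine (Eq.trans (by rfl) hswap).trans ?_
  simp only [fibreReducedOperator, fibreReducedIntegrand]
  refine congrArg (fun f : ℝ → (EuclideanSpace ℝ (Fin m) × ℝ) [⋀^Fin k]→L[ℝ] F ↦
    ∫ σ in (0 : ℝ)..1, f σ) (funext fun σ ↦ ?_)
  rw [MForm.inChart_eq_of_mem_target _ (hmem (σ * y.2)), hsymm, hT]
  exact (curryLeft_one_compContinuousLinearMap_prodMap (η (n, σ * y.2))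
    (e : EuclideanSpace ℝ (Fin m) →L[ℝ] EuclideanSpace ℝ (Fin m)) σ).symm

variable {J : Set ℝ}

/-- **The reduced fibre primitive of a form smooth on `N × J` is smooth on `N × J`** (`J` open,
star-shaped at `0`). [cite: McDuffSalamon2017, Lemma 3.2.1] -/
theorem smoothAt_fibrePrimitiveReduced {η : MForm ((𝓡 m).prod 𝓘(ℝ, ℝ)) (N × ℝ) F (k + 1)}
    (hJ : IsOpen J) (hJst : ∀ s ∈ J, ∀ σ ∈ Icc (0 : ℝ) 1, σ * s ∈ J)
    (hη : ∀ z : N × ℝ, z.2 ∈ J → η.SmoothAt z) {x₀ : N × ℝ} (hx₀ : x₀.2 ∈ J) :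
    (fibrePrimitiveReduced η).SmoothAt x₀ := by
  set U : Set (EuclideanSpace ℝ (Fin m) × ℝ) := (extChartAt (𝓡 m) x₀.1).target ×ˢ J with hU
  have hUo : IsOpen U := (isOpen_extChartAt_target (I := 𝓡 m) x₀.1).prod hJ
  have hK : ContDiffOn ℝ ∞ (fibreReducedOperator (η.inChart x₀)) U :=
    contDiffOn_fibreReducedOperator hUo (fun p hp σ hσ ↦ by
        have h := linHom_vertQ_mem_prod (m := m) hJst hp σ hσ
        exact h)
      (contDiffOn_inChart_prod hη x₀)
  have hcentre : extChartAt ((𝓡 m).prod 𝓘(ℝ, ℝ)) x₀ x₀ ∈ U := by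
    rw [extChartAt_prod]
    exact ⟨mem_extChartAt_target (I := 𝓡 m) x₀.1, by simpa using hx₀⟩
  have heq : ∀ y ∈ U, (fibrePrimitiveReduced η).inChart x₀ y = fibreReducedOperator (η.inChart x₀) y :=
    fun y hy ↦ inChart_fibrePrimitiveReduced η (mem_extChartAt_prod_real_target.2 hy.1)
  have hμ : ContDiffOn ℝ ∞ ((fibrePrimitiveReduced η).inChart x₀) U := hK.congr heq
  show ContDiffWithinAt ℝ ∞ ((fibrePrimitiveReduced η).inChart x₀) (range ((𝓡 m).prod 𝓘(ℝ, ℝ)))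
    (extChartAt ((𝓡 m).prod 𝓘(ℝ, ℝ)) x₀ x₀)
  exact ((hμ _ hcentre).contDiffAt (hUo.mem_nhds hcentre)).contDiffWithinAt

end ReducedManifold

end Literature.Geometry.Kaehler

end
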